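import Literature.NumberTheory.Transcendental.LineODEAlg
import Literature.NumberTheory.EllipticCurves.ComplexTorus
import Mathlib.Algebra.MvPolynomial.Funext
import HarnessLib

/-!
# Auxiliary forms on `M_κ` built from affine monomials do not vanish identically

Topic: `Literature/NumberTheory/Transcendental`. Plan item W4/S3 of the unit
`provefact-Literature.NumberTheory.Transcendental.H-b596640137`. The zero estimate
(`philippon1986_std`) is applied to a form `P` with `F_P = P(Θ) ≢ 0`; Siegel's lemma only gives
`P ≠ 0`. We therefore construct `P` as the **homogenisation** `homog D Q` (with respect to the
generic chart index `J₀ = (none, (0, none))`, `Θ_{J₀} = ∏_b σ(z'_b)³`) of a polynomial `Q` in the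
`n = |β| + |γ| + |δ|` affine coordinates

`A_{(j,(0,−))} = e^{y'_j}`, `A_{(−,(0[b↦1],−))} = ℘(z'_b)`, `A_{(−,(0,e))} = Ñ_e = s'_e - ∑_b κ_{eb} ζ(z'_b)`

(`affIdx`; these are generator values, `LineODEAlg.genFun_zero_eq_chartCoord`), and PROVE
(`exists_thetaEval_homog_ne_zero`): if `Q ≠ 0` then `F_{homog D Q} ≢ 0`. Indeed
`F_{homog D Q}(w) = Θ_{J₀}(w)^D · Q(A(w))` (`thetaEval_homog`), and the map
`w = (y', z', s') ↦ A(w)` hits every point of the box `(ℂ^×)^β × ℂ^γ × ℂ^δ` (`exp` onto `ℂ^×`,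
`℘` onto `ℂ` off the lattice — `PeriodPair.exists_weierstrassP_eq` — and `s' ↦ Ñ` a translation),
on which a non-zero polynomial cannot vanish (`MvPolynomial.funext_set`). The number of monomials
available for `Q` of degree `≤ D` is `C(D + n, n)`, the unknown count of the Siegel step.

## References

* A. Baker, G. Wüstholz, *Logarithmic Forms and Diophantine Geometry*, CUP 2007, §6.8 (p. 118:
  `P` is chosen not in the ideal of `G`).
-/

noncomputable section

open Complex MvPolynomial
open scoped PeriodPair

namespace Literature.NumberTheory.Transcendental

namespace GaGmE

namespace Std

variable {β γ δ : Type} [Fintype β] [Fintype γ] [Fintype δ] [DecidableEq γ]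
variable (L : PeriodPair) (κM : δ → γ → Kbar)

/-! ### Affine monomials and homogenisation -/

/-- The generic chart choice (no factor in the origin chart). [folklore] -/
def genericChart : γ → Bool := fun _ => false

/-- The generator carrying the affine coordinate `a`: `y_j ↦ E_j`, `z_b ↦ ℘_b`, `s_e ↦ Ñ_e`.
[folklore] -/
def affGen : β ⊕ (γ ⊕ δ) → Gen β γ δ
  | Sum.inl j => Sum.inl j
  | Sum.inr (Sum.inl b) => Sum.inr (Sum.inl (b, 0))
  | Sum.inr (Sum.inr e) => Sum.inr (Sum.inr e)

/-- The projective index of the affine coordinate `a` (generic chart). [folklore] -/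
def affIdx (a : β ⊕ (γ ⊕ δ)) : Option β × ThetaIdx γ δ :=
  genIdx (genericChart (γ := γ)) (affGen a)

/-- **Homogenisation** of degree `D` of a polynomial in the affine coordinates with respect to
`X_{J₀}`, `J₀` the generic base index: `∑_k X_{J₀}^{D-k} · (Q ∘ affIdx)_k`. [folklore] -/
def homog (D : ℕ) (Q : MvPolynomial (β ⊕ (γ ⊕ δ)) ℂ) : MvPolynomial (Option β × ThetaIdx γ δ) ℂ :=
  ∑ k ∈ Finset.range (D + 1), X (baseIdx (genericChart (γ := γ))) ^ (D - k) *
    homogeneousComponent k (rename affIdx Q)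

omit [Fintype β] [Fintype γ] [Fintype δ] in
/-- The homogenisation is homogeneous of degree `D`. [folklore] -/
theorem isHomogeneous_homog (D : ℕ) (Q : MvPolynomial (β ⊕ (γ ⊕ δ)) ℂ) :
    (homog D Q).IsHomogeneous D := by
  refine IsHomogeneous.sum _ _ _ fun k hk => ?_
  have hkD : k ≤ D := Nat.lt_succ_iff.mp (Finset.mem_range.mp hk)
  have h1 : (X (baseIdx (genericChart (γ := γ))) ^ (D - k) :
      MvPolynomial (Option β × ThetaIdx γ δ) ℂ).IsHomogeneous (D - k) := by
    simpa using (isHomogeneous_X ℂ (baseIdx (genericChart (γ := γ)))).pow (D - k)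
  have h2 := homogeneousComponent_isHomogeneous k (rename affIdx Q)
  simpa [Nat.sub_add_cancel hkD] using h1.mul h2

omit [Fintype β] [Fintype γ] [Fintype δ] in
/-- In the chart `X_{J₀} = 1` the homogenisation evaluates to `Q`: if `A_{J₀} = 1` and
`deg Q ≤ D` then `(homog D Q)(A) = Q(A ∘ affIdx)`. [folklore] -/
theorem eval_homog_of_base_eq_one {D : ℕ} {Q : MvPolynomial (β ⊕ (γ ⊕ δ)) ℂ}
    (hQ : Q.totalDegree ≤ D) {A : Option β × ThetaIdx γ δ → ℂ}
    (hA : A (baseIdx (genericChart (γ := γ))) = 1) :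
    MvPolynomial.eval A (homog D Q) = MvPolynomial.eval (A ∘ affIdx) Q := by
  simp only [homog, map_sum, map_mul, map_pow, eval_X, hA, one_pow, one_mul]
  rw [← map_sum, ← eval_rename]
  congr 1
  have hdeg : (rename affIdx Q).totalDegree ≤ D := (totalDegree_rename_le _ _).trans hQ
  conv_rhs => rw [← sum_homogeneousComponent (rename affIdx Q)]
  refine (Finset.sum_subset (fun k hk => ?_) fun k _ hk' => ?_).symm
  · exact Finset.mem_range.mpr (Nat.lt_succ_of_le ((Finset.mem_range_succ_iff.mp hk).trans hdeg))
  · rw [homogeneousComponent_eq_zero]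
    have : ¬ k < (rename affIdx Q).totalDegree + 1 := by simpa [Finset.mem_range] using hk'
    omega

variable {L}

omit [Fintype β] [Fintype δ] in
/-- **The auxiliary function in the generic chart**: where `Θ_{J₀}(w) ≠ 0`,
`F_{homog D Q}(w) = Θ_{J₀}(w)^D · Q(A(w) ∘ affIdx)`. [folklore] -/
theorem thetaEval_homog {D : ℕ} {Q : MvPolynomial (β ⊕ (γ ⊕ δ)) ℂ} (hQ : Q.totalDegree ≤ D)
    {w : β ⊕ (γ ⊕ δ) → ℂ} (h0 : theta L κM (baseIdx (genericChart (γ := γ))) w ≠ 0) :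
    thetaEval L κM (homog D Q) w = theta L κM (baseIdx (genericChart (γ := γ))) w ^ D *
      MvPolynomial.eval (fun a => chartCoord L κM (baseIdx (genericChart (γ := γ))) (affIdx a) w) Q := by
  rw [thetaEval_eq_pow_mul_eval_chart L κM (isHomogeneous_homog D Q) _ h0,
    eval_homog_of_base_eq_one hQ (chartCoord_self L κM h0)]
  rfl

/-! ### The affine coordinates take every value in a box with infinite sides -/

omit [Fintype β] [Fintype δ] in
/-- The affine coordinates at a point all of whose `E`-coordinates are off the lattice:
`(e^{y_j}, ℘(z_b), s_e - ∑_b κ_{eb} ζ(z_b))`. [folklore] -/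
theorem chartCoord_affIdx {w : β ⊕ (γ ⊕ δ) → ℂ} (hw : ∀ b, w (iz b) ∉ L.lattice) (a : β ⊕ (γ ⊕ δ)) :
    chartCoord L κM (baseIdx (genericChart (γ := γ))) (affIdx a) w =
      Sum.elim (fun j => cexp (w (iy j)))
        (Sum.elim (fun b => ℘[L] (w (iz b)))
          (fun e => w (is e) - ∑ b, (κM e b : ℂ) * L.weierstrassZeta (w (iz b)))) a := by
  have hc : (0 : ℂ) ∈ chartDomain L (genericChart (γ := γ)) w w := fun b => by
    simpa [FactorChartValid, genericChart] using hw b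
  rw [affIdx, ← genFun_zero_eq_chartCoord κM _ w w hc (affGen a)]
  rcases a with j | b | e <;> simp [affGen, genFun, genericChart]

omit [Fintype β] [Fintype δ] in
/-- **Every point of the box `(ℂ^×)^β × ℂ^γ × ℂ^δ` is a value of the affine coordinates** at a
point with all `E`-coordinates off the lattice (`exp` onto `ℂ^×`, `℘` onto `ℂ`, translation in
`s`). [folklore] -/
theorem exists_chartCoord_affIdx_eq (x : β ⊕ (γ ⊕ δ) → ℂ) (hx : ∀ j, x (iy j) ≠ 0) :
    ∃ w : β ⊕ (γ ⊕ δ) → ℂ, (∀ b, w (iz b) ∉ L.lattice) ∧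
      ∀ a, chartCoord L κM (baseIdx (genericChart (γ := γ))) (affIdx a) w = x a := by
  choose z hz hz℘ using fun b => PeriodPair.exists_weierstrassP_eq (L := L) (x (iz b))
  refine ⟨Sum.elim (fun j => Complex.log (x (iy j)))
    (Sum.elim z (fun e => x (is e) + ∑ b, (κM e b : ℂ) * L.weierstrassZeta (z b))), ?_, ?_⟩
  · intro b; simpa [iz] using hz b
  · have hw : ∀ b, (Sum.elim (fun j => Complex.log (x (iy j)))
        (Sum.elim z (fun e => x (is e) + ∑ b, (κM e b : ℂ) * L.weierstrassZeta (z b))) :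
          β ⊕ (γ ⊕ δ) → ℂ) (iz b) ∉ L.lattice := fun b => by simpa [iz] using hz b
    intro a
    rw [chartCoord_affIdx κM hw]
    rcases a with j | b | e
    · simpa [iy] using Complex.exp_log (hx j)
    · simpa [iz] using hz℘ b
    · simp [is, iz]

/-! ### Non-vanishing -/

omit [Fintype β] [Fintype δ] in
/-- **A form built from a non-zero affine polynomial does not vanish identically on `M_κ`.**
For `Q ≠ 0` of total degree `≤ D`: `F_{homog D Q} ≢ 0`. [cite: BakerWustholz2007, §6.8 (p. 118)] -/
theorem exists_thetaEval_homog_ne_zero {D : ℕ} {Q : MvPolynomial (β ⊕ (γ ⊕ δ)) ℂ}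
    (hQ : Q ≠ 0) (hD : Q.totalDegree ≤ D) :
    ∃ w, thetaEval L κM (homog D Q) w ≠ 0 := by
  by_contra! H
  apply hQ
  -- `Q` vanishes on the box `(ℂ^×)^β × ℂ^γ × ℂ^δ`
  refine MvPolynomial.funext_set (fun a : β ⊕ (γ ⊕ δ) => Sum.elim (fun _ => {u : ℂ | u ≠ 0})
      (fun _ => Set.univ) a) (fun a => ?_) fun x hx => ?_
  · rcases a with j | be
    · show Set.Infinite {u : ℂ | u ≠ 0}
      rw [show {u : ℂ | u ≠ 0} = ({0} : Set ℂ)ᶜ from Set.ext fun u => by simp]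
      exact (Set.finite_singleton (0 : ℂ)).infinite_compl
    · exact Set.infinite_univ
  · have hx' : ∀ j, x (iy j) ≠ 0 := fun j => by
      have := hx (iy j) (Set.mem_univ _)
      simpa [iy] using this
    obtain ⟨w, hw, hA⟩ := exists_chartCoord_affIdx_eq κM x hx'
    have h0 : theta L κM (baseIdx (genericChart (γ := γ))) w ≠ 0 := by
      have hc : (0 : ℂ) ∈ chartDomain L (genericChart (γ := γ)) w w := fun b => by
        simpa [FactorChartValid, genericChart] using hw b
      exact theta_baseIdx_ne_zero κM _ hc
    have key := H w
    rw [thetaEval_homog κM hD h0, mul_eq_zero, pow_eq_zero_iff', funext hA] at key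
    simpa [h0] using key

end Std

end GaGmE

end Literature.NumberTheory.Transcendental

end
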